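import Summits.ResolutionOfSingularities.ResolutionOfSingularities.Theorems.FrobeniusClosingSteerArithTransportWords
import Summits.ResolutionOfSingularities.ResolutionOfSingularities.Theorems.FrobeniusClosingSteerInitialFormOfCongruence
import Literature.AlgebraicGeometry.Resolution.RegularLocalOrderValuation
import Mathlib.Tactic.LinearCombination
import Mathlib.Tactic.Ring
import HarnessLib

/-!
# Crux `Steer` (stmt-ResolutionOfSingularities-16345), β-leaf debt K-β0 — LOCAL CONE LEMMAS at one stage
  (res-D-pv-053 g9; res-L0-w41-plan-1 RULING 303 (b); consumers: the K-β0 inductions — res-L0-w41-stub-3's `arithTransport_of_words`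
  and this seat's `ternaryConePersistsTwoN` / `arithPersistence` assembly — and the hS1b feed «arithmetic stage ⇒ odd-cleaned point step»)

OURS (campaign `res-hironaka`, rung L ★L-G4, slot W4.1). Candidates' vocabulary made kernel; nothing here is a statement of H. Hironaka's
manuscript [Hironaka2017] (status: under review). AI-written; AI review is weaker than expert review. Def-free, Theses-free, 0 sorries.

## What is proved (one stage `j` of a run, `p = 2`, characteristic `2`)

* `sq_sub_eval_not_mem_pow_succ` — the PARITY ENGINE: in a regular local ring with r.s.o.p. `x`, for a form `F` of ODD degree `v` with `F̄ ≠ 0`,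
  no square is congruent to `F(x)` modulo `𝔪^(v+1)` (`ord(e²) = 2·ord(e)` by `adicOrder_pow`, while the congruence pins `ord = v` by (G1)
  `NearPoint.mOrder_eq_of_congruence`).
* `cleanedOrder_of_cone` — a presentation `f − g² − Ψ(m₁, m₂) ∈ 𝔪^(d+1)` with `(m₁, m₂)` part of a r.s.o.p., `Ψ` a form of odd degree `d` and
  `Ψ̄ ≠ 0` PINS the cleaned order: `f − g² ∈ 𝔪^d` and `f − h² ∉ 𝔪^(d+1)` for every `h` (characteristic two: `(g + h)² = g² + h²`).
* run currency: `hasCleanedOrderAt_of_binaryConeE2At`, `hasCleanedOrderAt_of_anisotropicConeAt`, `hasCleanedOrderAt_of_arithBinaryResidueAt`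
  (L1 of `D/res-D-pv-053/K-BETA0A-SCOPE.md`: an `e = 2` / anisotropic / arithmetic cone of odd degree `d` at stage `j` ⇒ `HasCleanedOrderAt R s 2 j d`),
  `hasCleanedOrderAt_unique`, and `oddCleanedPointStepAt_of_arithBinaryResidueAt` (an arithmetic stage IS an odd-cleaned point step — the feed of
  hS1b's binder «odd-cleaned point steps beyond every bound» from the switch clause).
* `anisotropicImpliesE2_holds : ArithTransport.AnisotropicImpliesE2` (res-L0-w41-strat-2's bookkeeping word, p571472: an anisotropic binary cone has
  `e = 2` — `c·ℓ^d` vanishes at the kernel vector `(b, −a)` of `ℓ = aX + bY`, and is `0` for `a = b = 0`, `d ≥ 1`), and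
  `binaryConeE2At_of_arithBinaryResidueAt` (an arithmetic stage carries the K-β0(a) datum `IsPointStep ∧ BinaryConeE2At`).

[cite: ZariskiSamuel1960, Ch. VIII §1 Thm. 1] [cite: CossartJannsenSaito2020, §2.2 (p. 24)] [folklore]
-/

noncomputable section

-- `Summit.<S>.<S>.…` duplicates the summit name by design (single-problem summit).
set_option linter.dupNamespace false

open IsLocalRing MvPolynomial
open Literature.RingTheory.HilbertSamuel
open Literature.AlgebraicGeometry.Resolution
open Summit.ResolutionOfSingularities.ResolutionOfSingularities.Theorems.SwitchingDichotomy.Words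

namespace Summit.ResolutionOfSingularities.ResolutionOfSingularities.Theorems.SwitchingDichotomy.ArithTransport

namespace ConeLocal

universe u

/-! ## §1 The parity engine in a regular local ring -/

section Regular

variable {A : Type u} [CommRing A] [IsRegularLocalRing A] {n : ℕ} (hn : (maximalIdeal A).spanFinrank = n) (x : Fin n → A)
  (hx : Ideal.span (Set.range x) = maximalIdeal A)

include hn hx in
/-- **Parity engine.** In a regular local ring with r.s.o.p. `x`: if `F` is a form of ODD degree `v` with non-zero reduction, then no square `e²`
satisfies `e² − F(x) ∈ 𝔪^(v+1)` — the congruence would give `ord(e²) = v` ((G1)), but `ord(e²) = 2·ord(e)` is even or `⊤`.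
[cite: ZariskiSamuel1960, Ch. VIII §1 Thm. 1] -/
theorem sq_sub_eval_not_mem_pow_succ {v : ℕ} (hv : Odd v) (F : MvPolynomial (Fin n) A) (hF : F.IsHomogeneous v)
    (hF0 : MvPolynomial.map (residue A) F ≠ 0) (e : A) : e ^ 2 - eval x F ∉ maximalIdeal A ^ (v + 1) := by
  intro hmem
  have hord : mOrder (e ^ 2) = v := NearPoint.mOrder_eq_of_congruence hn x hx v F hF hF0 (e ^ 2) hmem
  have hpow : adicOrder (e ^ 2) = 2 * adicOrder e := adicOrder_pow e 2
  change adicOrder (e ^ 2) = v at hord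
  rw [hord] at hpow
  -- `adicOrder e` is finite (else `v = ⊤`) and `v = 2·k` contradicts oddness
  rcases (ENat.ne_top_iff_exists.mp (by
      intro htop
      rw [htop] at hpow
      exact ENat.coe_ne_top v (by rw [hpow]; simp)) : ∃ k : ℕ, (k : ℕ∞) = adicOrder e) with ⟨k, hk⟩
  rw [← hk] at hpow
  have h2 : v = 2 * k := by exact_mod_cast hpow
  obtain ⟨r, hr⟩ := hv
  omega

end Regular

/-! ## §2 A cone presentation with `Ψ̄ ≠ 0` pins the cleaned order (characteristic two) -/

section Local

variable {A : Type u} [CommRing A] [IsLocalRing A]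

/-- **The cleaned order from a cone.** In a local ring of characteristic two, a presentation `f − g² − Ψ(m₁, m₂) ∈ 𝔪^(d+1)` with `(m₁, m₂)` part of
a regular system of parameters, `Ψ` a form of ODD degree `d` and `Ψ̄ ≠ 0` gives `f − g² ∈ 𝔪^d` and `f − h² ∉ 𝔪^(d+1)` for EVERY `h`
(`(g + h)² = g² + h²` would be a square congruent to `Ψ(m)` modulo `𝔪^(d+1)`, against the parity engine). [folklore] -/
theorem cleanedOrder_of_cone [CharP A 2] {d : ℕ} (hd : Odd d) (f g m₁ m₂ : A) (Ψ : MvPolynomial (Fin 2) A)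
    (hm : IsRsopPart ![m₁, m₂]) (hΨ : Ψ.IsHomogeneous d)
    (hcong : f - g ^ 2 - eval ![m₁, m₂] Ψ ∈ maximalIdeal A ^ (d + 1)) (hΨ0 : MvPolynomial.map (residue A) Ψ ≠ 0) :
    f - g ^ 2 ∈ maximalIdeal A ^ d ∧ ∀ h : A, f - h ^ 2 ∉ maximalIdeal A ^ (d + 1) := by
  haveI : IsRegularLocalRing A := hm.isRegularLocalRing
  obtain ⟨e, x, hn, hx, hxz⟩ := hm.exists_rsop
  -- the form `Ψ` in the full system `x`
  set F : MvPolynomial (Fin (2 + e)) A := rename (Fin.castAdd e) Ψ with hFdef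
  have hcomp : x ∘ Fin.castAdd e = ![m₁, m₂] := funext fun i => hxz i
  have hFeval : eval x F = eval ![m₁, m₂] Ψ := by
    rw [hFdef, eval_rename, hcomp]
  have hF : F.IsHomogeneous d := hΨ.rename_isHomogeneous
  have hF0 : MvPolynomial.map (residue A) F ≠ 0 := by
    rw [hFdef, map_rename]
    exact fun h0 => hΨ0 (rename_injective _ (Fin.castAdd_injective _ _) (by rw [h0, map_zero]))
  have hΨm : eval ![m₁, m₂] Ψ ∈ maximalIdeal A ^ d := hFeval ▸ eval_mem_pow_of_isHomogeneous x hx hF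
  refine ⟨?_, fun h hh => ?_⟩
  · have : f - g ^ 2 = (f - g ^ 2 - eval ![m₁, m₂] Ψ) + eval ![m₁, m₂] Ψ := by ring
    rw [this]
    exact Ideal.add_mem _ (Ideal.pow_le_pow_right (Nat.le_succ d) hcong) hΨm
  · have h2 : (2 : A) = 0 := by exact_mod_cast CharP.cast_eq_zero A 2
    have key : (g + h) ^ 2 - eval x F = (f - g ^ 2 - eval ![m₁, m₂] Ψ) - (f - h ^ 2) + 2 * (g * h + g ^ 2) := by
      rw [hFeval]; ring
    rw [h2, zero_mul, add_zero] at key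
    exact sq_sub_eval_not_mem_pow_succ hn x hx hd F hF hF0 (g + h) (key ▸ Ideal.sub_mem _ hcong hh)

end Local

/-! ## §3 Run currency: cleaned order and odd-cleaned point steps from cone data -/

section Run

variable {K : Type} [Field K] [CharP K 2] {R : ℕ → Subring K} {P : (i : ℕ) → Ideal (R i)} {s : ℕ → K} {d j : ℕ}

/-- **L1 (e = 2 form).** An `e = 2` binary cone of odd degree `d` at stage `j` pins the cleaned order: `HasCleanedOrderAt R s 2 j d`. [folklore] -/
theorem hasCleanedOrderAt_of_binaryConeE2At (hd : Odd d) (h : BinaryConeE2At R s 2 d j) : HasCleanedOrderAt R s 2 j d := by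
  obtain ⟨hloc, hs, g, m₁, m₂, Ψ, hm, hΨ, hcong, hne⟩ := h
  have hΨ0 : MvPolynomial.map (residue (R j)) Ψ ≠ 0 := by
    intro h0
    exact hne ⟨0, 0, 0, by rw [h0, map_zero, zero_mul]⟩
  obtain ⟨h1, h2⟩ := cleanedOrder_of_cone hd _ g m₁ m₂ Ψ hm hΨ hcong hΨ0
  exact ⟨hloc, hs, ⟨g, h1⟩, h2⟩

/-- **L1 (anisotropic form).** An anisotropic binary cone of odd degree `d` at stage `j` pins the cleaned order. [folklore] -/
theorem hasCleanedOrderAt_of_anisotropicConeAt (hd : Odd d) (h : AnisotropicConeAt R s 2 d j) : HasCleanedOrderAt R s 2 j d := by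
  obtain ⟨hloc, hs, g, m₁, m₂, Ψ, hm, hΨ, hcong, han⟩ := h
  have hΨ0 : MvPolynomial.map (residue (R j)) Ψ ≠ 0 := by
    intro h0
    exact han 1 0 (Or.inl one_ne_zero) (by rw [h0, map_zero])
  obtain ⟨h1, h2⟩ := cleanedOrder_of_cone hd _ g m₁ m₂ Ψ hm hΨ hcong hΨ0
  exact ⟨hloc, hs, ⟨g, h1⟩, h2⟩

/-- **L1 (arithmetic form).** An arithmetic binary residue of odd degree `d` at stage `j` pins the cleaned order. [folklore] -/
theorem hasCleanedOrderAt_of_arithBinaryResidueAt (hd : Odd d) (h : ArithBinaryResidueAt R P s 2 d j) : HasCleanedOrderAt R s 2 j d :=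
  hasCleanedOrderAt_of_anisotropicConeAt hd ((arithBinaryResidueAt_iff R P s 2 d j).mp h).2

omit [CharP K 2] in
/-- **Cleaned orders are unique.** [folklore] -/
theorem hasCleanedOrderAt_unique {ν ν' : ℕ} (h : HasCleanedOrderAt R s 2 j ν) (h' : HasCleanedOrderAt R s 2 j ν') : ν = ν' := by
  obtain ⟨hloc, hs, ⟨g, hg⟩, hmax⟩ := h
  obtain ⟨hloc', hs', ⟨g', hg'⟩, hmax'⟩ := h'
  by_contra hne
  rcases Nat.lt_or_gt_of_ne hne with hlt | hlt
  · exact hmax g' (Ideal.pow_le_pow_right (Nat.succ_le_of_lt hlt) hg')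
  · exact hmax' g (Ideal.pow_le_pow_right (Nat.succ_le_of_lt hlt) hg)

/-- **An arithmetic stage is an odd-cleaned point step** (feeds hS1b's binder «odd-cleaned point steps beyond every bound» from the switch clause
`Words.ArithSwitchClause`). [folklore] -/
theorem oddCleanedPointStepAt_of_arithBinaryResidueAt (hd : Odd d) (h : ArithBinaryResidueAt R P s 2 d j) : OddCleanedPointStepAt R P s 2 j := by
  obtain ⟨hloc, hs, hex, hmax⟩ := hasCleanedOrderAt_of_arithBinaryResidueAt hd h
  exact ⟨h.1, hloc, hs, d, hd, hex, hmax⟩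

/-- From the switch clause: odd-cleaned point steps occur beyond every bound. [folklore] -/
theorem oddCleaned_io_of_arithSwitchClause (h : ArithSwitchClause R P s 2) : ∀ i₀ : ℕ, ∃ i, i₀ ≤ i ∧ OddCleanedPointStepAt R P s 2 i := by
  obtain ⟨d, hd, -, hio⟩ := h
  intro i₀
  obtain ⟨i, hi, harith⟩ := hio i₀
  exact ⟨i, hi, oddCleanedPointStepAt_of_arithBinaryResidueAt hd harith⟩

end Run

/-! ## §4 Anisotropic ⇒ `e = 2` -/

/-- **`AnisotropicImpliesE2` holds** (res-L0-w41-strat-2's bookkeeping word, `…ArithTransportWords`): an anisotropic binary cone of degree `d ≥ 1`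
is not `c·(aX + bY)^d` — that form vanishes at `(b, −a) ≠ 0`, and for `a = b = 0` it is `0` and vanishes at `(1, 0)`. [folklore] -/
theorem anisotropicImpliesE2_holds : AnisotropicImpliesE2 := by
  intro K _ R s p d j hd h
  obtain ⟨hloc, hs, g, m₁, m₂, Ψ, hm, hΨ, hcong, han⟩ := h
  refine ⟨hloc, hs, g, m₁, m₂, Ψ, hm, hΨ, hcong, ?_⟩
  rintro ⟨a, b, c, hΨeq⟩
  by_cases hab : a = 0 ∧ b = 0
  · obtain ⟨rfl, rfl⟩ := hab
    refine han 1 0 (Or.inl one_ne_zero) ?_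
    rw [hΨeq]
    obtain ⟨d', rfl⟩ := Nat.exists_eq_add_of_le hd
    simp
  · have hba : b ≠ 0 ∨ -a ≠ 0 := by
      by_cases hb : b = 0
      · exact Or.inr (neg_ne_zero.mpr fun ha => hab ⟨ha, hb⟩)
      · exact Or.inl hb
    refine han b (-a) hba ?_
    rw [hΨeq]
    simp only [map_mul, map_pow, map_add, eval_C, eval_X, Matrix.cons_val_zero, Matrix.cons_val_one]
    have : a * b + b * -a = 0 := by ring
    rw [this, zero_pow (by omega), mul_zero]

section Run

variable {K : Type} [Field K] {R : ℕ → Subring K} {P : (i : ℕ) → Ideal (R i)} {s : ℕ → K} {d j : ℕ}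

/-- **An arithmetic stage carries the K-β0(a) datum**: `IsPointStep ∧ BinaryConeE2At` (degree `d ≥ 1`). [folklore] -/
theorem binaryConeE2At_of_arithBinaryResidueAt (hd : 1 ≤ d) (h : ArithBinaryResidueAt R P s 2 d j) :
    IsPointStep R P j ∧ BinaryConeE2At R s 2 d j :=
  ⟨h.1, anisotropicImpliesE2_holds K R s 2 d j hd ((arithBinaryResidueAt_iff R P s 2 d j).mp h).2⟩

end Run

end ConeLocal

end Summit.ResolutionOfSingularities.ResolutionOfSingularities.Theorems.SwitchingDichotomy.ArithTransport

end
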